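import Summits.BirchSwinnertonDyer.Rank1Residual.Additive.RamifiedSevenGenusKatoShapes
import Summits.BirchSwinnertonDyer.Rank1Residual.Additive.RamifiedSevenGenusOrientedFactorisation
import Summits.BirchSwinnertonDyer.Rank1Residual.Additive.RamifiedSevenKatoMuEqualityOfResidualNonvanishing
import Literature.NumberTheory.EllipticCurves.Kato2004.AdmissibleZetaClassUniformPositionProofs
import HarnessLib

set_option autoImplicit false

/-!
# `𝒞₇` genus road (crux `EllipticUnitValueSevenOfGZK`, K7r), block (B3): RESIDUAL NON-VANISHING FROM THE GENUS
# RESIDUE — `z₀ ∉ 7·𝐇¹` for every admissible class at every member, FROM the genus residue (row A: K1ᵘ ⟹ (G6)) and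
# crux K2ᶜ's weak form on a Kato-side frame (memo §9 (G7′) + §4 LEMMA L / LATTICE LEMMA + (P0)); THEOREMS ONLY

Cell bsd-cm, seat bsd-cm-prr-ty1 g28 (literature-prover), row (GENUS-PORT-B) of the scope `SCOPE-GENUS-PORT-F8.md`
(16530c741a99cc96), SUMMON 1c4b9c2558877aeb; frozen proof-memo `MEMO-bsd-cm-genus` v1 (a38f3eedd2c92d58) §0 (d)–(f), §4,
§9, §10.  THEOREMS ONLY (no `def`, no named fact, no instance, no notation, no `sorry`); imports = (B1b)
`RamifiedSevenGenusKatoShapes` (the frame `KatoGenusFrame`, the weak form `ResidueIsGenusUnitClassShape`, the value pin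
`IsNormedEllipticUnitFamily`), the (K2-PORT) p765067 (for `X12.ClassCSeven` and the crux currency), and the Literature
PROOFS file `Kato2004/AdmissibleZetaClassUniformPositionProofs` (admissible classes against the ★-position witness).
The kernel blueprint `Cruxes/EllipticUnitValueSevenOfGZK/KatoGenusResidueSketch.lean` (5a996a18d1327d07: `k2_transfer_of_split`,
`k2_of_genusResidue_seven`) is RE-PROVED here on the frame and never imported (D841).

## What is proved (kernel), in proof order

* §1 LEMMA L on the frame (`KatoGenusFrame.zW_ne_of_zS_ne`; memo §4, blueprint `k2_transfer_of_split` with `HW := 𝐇′(S′_W)`):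
  if the split-vertex class `zS = 𝐳_{γ_{S′_W}⁺}` is `π`-indivisible in `𝐇′(S′_W)` then `zW = u·π^a·zS` (`a ≤ 1`) is not
  `7 = v·π²` times a class of `𝐇′(S′_W)`.
* §2 (P0)(iii) DERIVED (`KatoGenusFrame.exists_units_smul_zW_eq_j`): every admissible `z₀ ∈ I.H` has `j z₀ = w·zW` for a
  unit `w` of `Λ` — from the frame's ★-pin `j zOne = 7^k·zW` and the Literature lemma
  `IsAdmissibleZetaClass.exists_pow_smul_eq_units_smul` (`7^k·z₀ = w·zOne`), cancelling `7^k` in the `π`-torsion-free `𝐇′(𝒱′)`.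
* §3 THE TRANSFER AT ONE FRAME (`KatoGenusFrame.not_mem_augIdealP_smul_top`): weak form K2ᶜ on `Φ` + genus residue of
  `d` non-zero ⟹ every admissible `z₀` of the pin `I` satisfies `z₀ ∉ augIdealP 7 • ⊤` — (B1b)'s `zS_ne_pi_smul` ((G7′),
  (K2_S)), §1, §2, and the currency bridge `augIdealP 7 • ⊤ = 7·I.H` (row A's `mem_span_singleton_smul_top_iff`).
* §4 THE SKELETON-FACING STATEMENT `residualNonvanishingSeven_of_genus (hRes) (hK2c) : RNV7`, where RNV7 is the body of
  `KatoMuAbelianResidueSketch.ResidualNonvanishingSeven` (l. 214) VERBATIM = the `hK2` binder of p765067's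
  `KatoMuResidual.stubKatoMuEqualitySeven_of_residualNonvanishing` letter for letter (so the pen's zp v11 feeds it by
  `exact`); `hRes` = «every value-pinned genus frame carries a datum with non-zero genus residue» (= the pen's K1ᵘ stub
  composed with row A's (B2)/(B2′): `fun F θu h => ⟨d′.toGenusDatum, orientedGenusFactorisationShape_imp_genusResidueNonzeroShape
  h₄ h₂ h₂' F θu d′ hd′⟩` once (B2′) lands, or `(hK1 F θu h).imp (genusFactorisationShape_imp_genusResidueNonzeroShape h₄ h₂ h₂' F θu)`
  against (B2)); `hK2c` = THE CLOSED FORM OF K2ᶜ OVER (B1b)'s SHAPE that the pen registers as `stub_residueIsGenusUnitClassSeven`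
  (copied from this binder letter for letter): «for every `W ∈ 𝒞₇` and cyclotomic datum `(K, hK, γ, I)` there is a value-pinned
  genus frame `(F, θu)` such that every genus datum `d` over it carries a Kato-side frame `Φ : KatoGenusFrame W K hK I d` with
  `ResidueIsGenusUnitClassShape Φ`» — caveat (κ) of (B1b)'s module docstring applies («≈ (K2_S) ∧ pins»; the existence of
  the genus frame `(F, θu)` of the member is folded into this ∃, as the scope's «instantiated at the frame (f_D, 7, K ⊂ ℚ(ζ_{7^∞}))»).

HONEST LABEL: conditional theorems; K1ᵘ, K2ᶜ, (E2) remain the pen's stubs; nothing about Kato's Conj. 12.10,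
`X12.CMRamifiedSeven` or BSD is asserted; stmt-BirchSwinnertonDyer-19945 is OPEN; no summit statement is proved by this
seat; BSD is claimed for no curve.  References: K. Kato, Astérisque 295 (2004) Thm. 12.4 (2), Thm. 12.5 (1) (p. 221), §13.9
(p. 230), 15.14 (p. 264), (15.16.1) (p. 265) [Kato2004Asterisque]; frozen memo §4 (L3)–(L4), LEMMA L, §9 (G7′), §10.
-/

noncomputable section

open scoped Classical NumberField

open WeierstrassCurve Literature.NumberTheory.EllipticCurves
open Literature.NumberTheory.EllipticCurves.IwasawaAlgebra
open Literature.NumberTheory.EllipticCurves.Kato2004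
open Literature.NumberTheory.ComplexMultiplication.EllipticUnits
open Summit.BirchSwinnertonDyer.Rank1Residual

namespace Summit.BirchSwinnertonDyer.Rank1Residual.Additive.GenusSeven

section Frame

variable {W : WeierstrassCurve ℚ} [W.IsElliptic] [W.IsGloballyMinimal] [Fact (Nat.Prime 7)]
  [ContinuousSMul ℤ_[7] (W.tateModule 7)] {K : ZpExtension ℚ 7} {hK : K.IsCyclotomic}
  {γ : Field.absoluteGaloisGroup ℚ} {I : IwasawaH1Data W 7 K γ}
  {F : GenusFrame} {θu : ∀ n : ℕ, globalUnitsOf (F.layer n)} {d : GenusDatum F θu}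

namespace KatoGenusFrame

/-! ## §1 LEMMA L on the frame: (K2_S) ⟹ `𝐳_{γ_W} ∉ 7·𝐇′(S′_W)` -/

/-- **LEMMA L (memo §4; blueprint `k2_transfer_of_split` with `HW := 𝐇′(S′_W)`), on the frame**: if
`zS = 𝐳_{γ_{S′_W}⁺}` is not `π` times a class of `𝐇′(S′_W)`, then `zW = u·π^a·zS` (`u` a unit, `a ≤ 1`) is not
`(v·π²)` times a class of `𝐇′(S′_W)` — because `𝐇′(𝒱′)` has no `π`-torsion and `2 − a ≥ 1`. Kernel.
[cite: Kato2004Asterisque, Thm. 12.4 (2) (p. 221, "torsion free") and Lemma 15.11 (1) (p. 261, the split lattice)] -/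
theorem zW_ne_of_zS_ne (Φ : KatoGenusFrame W K hK I d) (hS : ∀ h ∈ Φ.frame.HS, Φ.zS ≠ Φ.π • h) :
    ∀ h ∈ Φ.frame.HS, Φ.zW ≠ ((Φ.v : Φ.R) * Φ.π ^ 2) • h := by
  intro h hh hcontra
  have key : ∀ y ∈ Φ.frame.HS, (Φ.u : Φ.R) • Φ.zS = Φ.π • y → False := by
    intro y hy hwy
    refine hS (((Φ.u⁻¹ : Φ.Rˣ) : Φ.R) • y) (Φ.frame.HS.smul_mem _ hy) ?_
    have h2 := congrArg (fun x => ((Φ.u⁻¹ : Φ.Rˣ) : Φ.R) • x) hwy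
    simp only [smul_smul, Units.inv_mul, one_smul] at h2
    rw [h2, smul_smul, mul_comm]
  rw [zW_def] at hcontra
  rcases Nat.le_one_iff_eq_zero_or_eq_one.mp Φ.a_le_one with ha | ha
  · rw [ha, pow_zero, one_smul] at hcontra
    refine key (((Φ.v : Φ.R) * Φ.π) • h) (Φ.frame.HS.smul_mem _ hh) ?_
    rw [hcontra, smul_smul]
    congr 1
    ring
  · rw [ha, pow_one] at hcontra
    have e1 : Φ.π • ((Φ.u : Φ.R) • Φ.zS) = Φ.π • (((Φ.v : Φ.R) * Φ.π) • h) := by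
      rw [smul_comm, hcontra, smul_smul]
      congr 1
      ring
    have e2 : (Φ.u : Φ.R) • Φ.zS = ((Φ.v : Φ.R) * Φ.π) • h :=
      sub_eq_zero.mp (Φ.torsionFree_π _ (by rw [smul_sub, e1, sub_self]))
    refine key ((Φ.v : Φ.R) • h) (Φ.frame.HS.smul_mem _ hh) ?_
    rw [e2, smul_smul, mul_comm]

/-! ## §2 (P0)(iii) derived: an admissible class maps to a `Λˣ`-multiple of `𝐳_{γ_W}` -/

/-- **Every admissible class of the pin `I` maps to a unit multiple of `zW = 𝐳_{γ_W}` in `𝐇′(𝒱′)`** (memo (P0)(iii),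
DERIVED): `7^k·z₀ = w·zOne` (★-position, `IsAdmissibleZetaClass.exists_pow_smul_eq_units_smul`) and `j zOne = 7^k·zW`
give `7^k·(j z₀ − w·zW) = 0`, and `𝐇′(𝒱′)` has no `7`-torsion. Kernel.
[cite: Kato2004Asterisque, Thm. 12.5 (1) (p. 221) and §13.9 (p. 230, "independent of the choices")] -/
theorem exists_units_smul_zW_eq_j (Φ : KatoGenusFrame W K hK I d) (hγ : K.IsTopGenerator γ) {z₀ : I.H}
    (hz₀ : IsAdmissibleZetaClass W 7 K hK I z₀) :
    ∃ w : (IwasawaAlgebra 7)ˣ, Φ.j z₀ = (w : IwasawaAlgebra 7) • Φ.zW := by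
  obtain ⟨w, hw⟩ := hz₀.exists_pow_smul_eq_units_smul hγ Φ.zOne_pos
  simp only [Nat.cast_ofNat] at hw
  refine ⟨w, sub_eq_zero.mp (Φ.torsionFree_seven_pow Φ.k _ ?_)⟩
  have h1 : ((7 : IwasawaAlgebra 7) ^ Φ.k) • Φ.j z₀ =
      ((7 : IwasawaAlgebra 7) ^ Φ.k) • ((w : IwasawaAlgebra 7) • Φ.zW) := by
    rw [← map_smul, hw, map_smul, Φ.j_zOne_eq_pow_smul_zW, smul_comm]
  rw [smul_sub, h1, sub_self]

/-! ## §3 The transfer at one frame: K2ᶜ-weak + genus residue `≠ 0` ⟹ `z₀ ∉ 7·𝐇¹` for every admissible `z₀` -/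

/-- **THE TRANSFER AT ONE FRAME** (memo §9 (G7′) + §4 LEMMA L + §10): if a Kato-side frame `Φ` of `(W, K, hK, I)` over the
genus datum `d` satisfies crux K2ᶜ's weak form and the genus residue of `d` is non-zero, then every admissible Kato zeta
class `z₀ ∈ I.H = 𝐇¹_Γ(T₇W)` is `7`-PRIMITIVE: `z₀ ∉ augIdealP 7 • ⊤ = 7·𝐇¹`.  Proof: (B1b) `zS_ne_pi_smul` gives (K2_S);
§1 gives `zW ∉ (vπ²)·𝐇′(S′_W)`; if `z₀ = 7·y` then `w·zW = j z₀ = (vπ²)·j y` (§2, `j_seven_smul`), i.e.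
`zW = (vπ²)·j(w⁻¹y)` with `j(w⁻¹y) ∈ 𝐇′(S′_W)` — contradiction. Kernel (= blueprint `k2_of_genusResidue_seven`).
[cite: Kato2004Asterisque, (15.16.1) (p. 265), 15.14 (p. 264), Thm. 12.4 (2) (p. 221)] -/
theorem not_mem_augIdealP_smul_top (Φ : KatoGenusFrame W K hK I d) (hγ : K.IsTopGenerator γ)
    (hshape : ResidueIsGenusUnitClassShape Φ) (hres : GenusResidueNonzeroShape d)
    {z₀ : I.H} (hz₀ : IsAdmissibleZetaClass W 7 K hK I z₀) :
    z₀ ∉ (IwasawaAlgebra.augIdealP 7 • (⊤ : Submodule (IwasawaAlgebra 7) I.H)) := by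
  intro hmem
  rw [augIdealP, mem_span_singleton_smul_top_iff] at hmem
  obtain ⟨y, hy⟩ := hmem
  obtain ⟨w, hw⟩ := Φ.exists_units_smul_zW_eq_j hγ hz₀
  have h7 : (PowerSeries.C ((7 : ℕ) : ℤ_[7]) : IwasawaAlgebra 7) = 7 := by rw [map_natCast, Nat.cast_ofNat]
  have h2 : (w : IwasawaAlgebra 7) • Φ.zW = ((Φ.v : Φ.R) * Φ.π ^ 2) • Φ.j y := by
    rw [← hw, hy, h7, Φ.j_seven_smul]
  have hzW : Φ.zW = ((Φ.v : Φ.R) * Φ.π ^ 2) • Φ.j (((w⁻¹ : (IwasawaAlgebra 7)ˣ) : IwasawaAlgebra 7) • y) := by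
    calc Φ.zW = ((w⁻¹ : (IwasawaAlgebra 7)ˣ) : IwasawaAlgebra 7) • ((w : IwasawaAlgebra 7) • Φ.zW) := by
            rw [smul_smul, Units.inv_mul, one_smul]
      _ = ((w⁻¹ : (IwasawaAlgebra 7)ˣ) : IwasawaAlgebra 7) • (((Φ.v : Φ.R) * Φ.π ^ 2) • Φ.j y) := by rw [h2]
      _ = ((Φ.v : Φ.R) * Φ.π ^ 2) • Φ.j (((w⁻¹ : (IwasawaAlgebra 7)ˣ) : IwasawaAlgebra 7) • y) := by
            rw [map_smul, smul_comm]
  exact Φ.zW_ne_of_zS_ne (Φ.zS_ne_pi_smul hshape hres) _ (Φ.j_mem _) hzW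

end KatoGenusFrame

end Frame

/-! ## §4 The skeleton-facing statement: RNV7 (VERBATIM `ResidualNonvanishingSeven`) from the genus residue and K2ᶜ -/

/-- **RESIDUAL NON-VANISHING ON `𝒞₇` FROM THE GENUS RESIDUE AND CRUX K2ᶜ** — the conclusion is letter for letter the
body of `KatoMuAbelianResidueSketch.ResidualNonvanishingSeven` (= the `hK2` binder of p765067's
`KatoMuResidual.stubKatoMuEqualitySeven_of_residualNonvanishing`).  INPUTS: `hRes` — every value-pinned genus frame
carries a datum whose genus residue is non-zero (the pen's K1ᵘ stub composed with row A's (B2)/(B2′) theorem, or (B5));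
`hK2c` — THE CLOSED FORM OF CRUX K2ᶜ over (B1b)'s shape (the pen's `stub_residueIsGenusUnitClassSeven`, copied from this
binder): every `𝒞₇` member and cyclotomic datum has a value-pinned genus frame `(F, θu)` over each of whose data `d` there is
a Kato-side frame satisfying `ResidueIsGenusUnitClassShape` (caveat (κ) of (B1b): «≈ (K2_S) ∧ pins»).  Proof: §3 at the
frame supplied by `hK2c` and the datum supplied by `hRes`.  CONDITIONAL; nothing asserted; 19945 stays OPEN.
[cite: Kato2004Asterisque, (15.16.1) (p. 265), Thm. 12.5 (1) (p. 221), Conj. 12.10 (p. 224)] [cite: Tsuji1999, Thm 3.1 (i) (p. 6)]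
[cite: FerreroWashington1979, main theorem] -/
theorem residualNonvanishingSeven_of_genus
    (hRes : ∀ (F : GenusFrame) (θu : ∀ n : ℕ, globalUnitsOf (F.layer n)), IsNormedEllipticUnitFamily F θu →
      ∃ d : GenusDatum F θu, GenusResidueNonzeroShape d)
    (hK2c : ∀ (W : WeierstrassCurve ℚ) [W.IsElliptic] [W.IsGloballyMinimal] [Fact (Nat.Prime 7)], X12.ClassCSeven W →
      letI : ContinuousSMul ℤ_[7] (W.tateModule 7) := TateModule.continuousSMul_padicInt
      ∀ (K : ZpExtension ℚ 7) (hK : K.IsCyclotomic) (γ : Field.absoluteGaloisGroup ℚ) (_ : K.IsTopGenerator γ)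
        (I : IwasawaH1Data W 7 K γ),
        ∃ (F : GenusFrame) (θu : ∀ n : ℕ, globalUnitsOf (F.layer n)), IsNormedEllipticUnitFamily F θu ∧
          ∀ d : GenusDatum F θu, ∃ Φ : KatoGenusFrame W K hK I d, ResidueIsGenusUnitClassShape Φ) :
    ∀ (W : WeierstrassCurve ℚ) [W.IsElliptic] [W.IsGloballyMinimal] [Fact (Nat.Prime 7)], X12.ClassCSeven W →
      letI : ContinuousSMul ℤ_[7] (W.tateModule 7) := TateModule.continuousSMul_padicInt
      ∀ (K : ZpExtension ℚ 7) (hK : K.IsCyclotomic) (γ : Field.absoluteGaloisGroup ℚ) (_ : K.IsTopGenerator γ)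
        (I : IwasawaH1Data W 7 K γ) (z₀ : I.H), Kato2004.IsAdmissibleZetaClass W 7 K hK I z₀ →
        z₀ ∉ (IwasawaAlgebra.augIdealP 7 • (⊤ : Submodule (IwasawaAlgebra 7) I.H)) := by
  intro W _ _ _ hC K hK γ hγ I z₀ hz₀
  haveI : ContinuousSMul ℤ_[7] (W.tateModule 7) := TateModule.continuousSMul_padicInt
  obtain ⟨F, θu, hpin, hΦ⟩ := hK2c W hC K hK γ hγ I
  obtain ⟨d, hres⟩ := hRes F θu hpin
  obtain ⟨Φ, hshape⟩ := hΦ d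
  exact Φ.not_mem_augIdealP_smul_top hγ hshape hres hz₀

/-- **RNV7 FROM THE PEN'S THREE INPUTS BY ONE `exact`** — the printed facts of row A's (G6) (Tsuji's Coleman map,
Ferrero–Washington in its two series forms), the K1ᵘ stub of record in row A's ORIENTED closed form
(`∀ F θu, IsNormedEllipticUnitFamily F θu → ∃ d : OrientedGenusDatum F θu, OrientedGenusFactorisationShape d`, file
`RamifiedSevenGenusOrientedFactorisation.lean`), and the K2ᶜ stub `hK2c` as above; row A's glue
`exists_genusResidueNonzero_of_orientedK1u` supplies `hRes` at `d′.toGenusDatum`.  CONDITIONAL; nothing asserted; 19945 OPEN.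
[cite: Kato2004Asterisque, (15.16.1) (p. 265), Conj. 12.10 (p. 224)] [cite: Tsuji1999, Thm 3.1 (i) (p. 6)]
[cite: FerreroWashington1979, main theorem] [cite: Lang1990, Ch. 10 §2 Thm. 2.3 (PDF p. 172)] -/
theorem residualNonvanishingSeven_of_orientedGenus
    (h₄ : Literature.NumberTheory.IwasawaTheory.tsuji1999_thm31_colemanMap)
    (h₂ : Literature.NumberTheory.IwasawaTheory.ferreroWashington_kubotaLeopoldtSeries_unitCoeff)
    (h₂' : Literature.NumberTheory.IwasawaTheory.ferreroWashington_stickelbergerSeries_unitCoeff)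
    (hK1u : ∀ (F : GenusFrame) (θu : ∀ n : ℕ, globalUnitsOf (F.layer n)), IsNormedEllipticUnitFamily F θu →
      ∃ d : OrientedGenusDatum F θu, OrientedGenusFactorisationShape d)
    (hK2c : ∀ (W : WeierstrassCurve ℚ) [W.IsElliptic] [W.IsGloballyMinimal] [Fact (Nat.Prime 7)], X12.ClassCSeven W →
      letI : ContinuousSMul ℤ_[7] (W.tateModule 7) := TateModule.continuousSMul_padicInt
      ∀ (K : ZpExtension ℚ 7) (hK : K.IsCyclotomic) (γ : Field.absoluteGaloisGroup ℚ) (_ : K.IsTopGenerator γ)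
        (I : IwasawaH1Data W 7 K γ),
        ∃ (F : GenusFrame) (θu : ∀ n : ℕ, globalUnitsOf (F.layer n)), IsNormedEllipticUnitFamily F θu ∧
          ∀ d : GenusDatum F θu, ∃ Φ : KatoGenusFrame W K hK I d, ResidueIsGenusUnitClassShape Φ) :
    ∀ (W : WeierstrassCurve ℚ) [W.IsElliptic] [W.IsGloballyMinimal] [Fact (Nat.Prime 7)], X12.ClassCSeven W →
      letI : ContinuousSMul ℤ_[7] (W.tateModule 7) := TateModule.continuousSMul_padicInt
      ∀ (K : ZpExtension ℚ 7) (hK : K.IsCyclotomic) (γ : Field.absoluteGaloisGroup ℚ) (_ : K.IsTopGenerator γ)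
        (I : IwasawaH1Data W 7 K γ) (z₀ : I.H), Kato2004.IsAdmissibleZetaClass W 7 K hK I z₀ →
        z₀ ∉ (IwasawaAlgebra.augIdealP 7 • (⊤ : Submodule (IwasawaAlgebra 7) I.H)) :=
  residualNonvanishingSeven_of_genus
    (fun F θu h => by
      obtain ⟨d, -, hd⟩ := exists_genusResidueNonzero_of_orientedK1u h₄ h₂ h₂' hK1u F θu h
      exact ⟨d.toGenusDatum, hd⟩)
    hK2c

/-- **… hence v9's stub 2b (Kato's `μ`-equality at `(7)`) from the genus inputs**, through p765067's (P2)
`KatoMuResidual.stubKatoMuEqualitySeven_of_residualNonvanishing` — the byte-check that RNV7 above IS its `hK2` binder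
(`exact` typechecks). CONDITIONAL; nothing asserted.
[cite: Kato2004Asterisque, Conj. 12.10 (p. 224)] [cite: CoatesSujatha2005, Cor. 3.6] [cite: FerreroWashington1979, main theorem] -/
theorem stubKatoMuEqualitySeven_of_genus
    (hchar : Literature.NumberTheory.IwasawaTheory.classicalMuVanishes_finite_unramifiedClasses)
    (hFW : Literature.NumberTheory.IwasawaTheory.ferreroWashington1979_classicalMuVanishes)
    (hGZK : rank_eq_analyticRank_of_analyticRank_le_one)
    (hRes : ∀ (F : GenusFrame) (θu : ∀ n : ℕ, globalUnitsOf (F.layer n)), IsNormedEllipticUnitFamily F θu →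
      ∃ d : GenusDatum F θu, GenusResidueNonzeroShape d)
    (hK2c : ∀ (W : WeierstrassCurve ℚ) [W.IsElliptic] [W.IsGloballyMinimal] [Fact (Nat.Prime 7)], X12.ClassCSeven W →
      letI : ContinuousSMul ℤ_[7] (W.tateModule 7) := TateModule.continuousSMul_padicInt
      ∀ (K : ZpExtension ℚ 7) (hK : K.IsCyclotomic) (γ : Field.absoluteGaloisGroup ℚ) (_ : K.IsTopGenerator γ)
        (I : IwasawaH1Data W 7 K γ),
        ∃ (F : GenusFrame) (θu : ∀ n : ℕ, globalUnitsOf (F.layer n)), IsNormedEllipticUnitFamily F θu ∧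
          ∀ d : GenusDatum F θu, ∃ Φ : KatoGenusFrame W K hK I d, ResidueIsGenusUnitClassShape Φ) :
    ∀ (W : WeierstrassCurve ℚ) [W.IsElliptic] [W.IsGloballyMinimal] [Fact (Nat.Prime 7)], X12.ClassCSeven W →
      letI : ContinuousSMul ℤ_[7] (W.tateModule 7) := TateModule.continuousSMul_padicInt
      ∀ (K : ZpExtension ℚ 7) (hK : K.IsCyclotomic) (γ : Field.absoluteGaloisGroup ℚ) (_ : K.IsTopGenerator γ)
        (I : IwasawaH1Data W 7 K γ) (z₀ : I.H), Kato2004.IsAdmissibleZetaClass W 7 K hK I z₀ →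
        ∀ (Y : W.FineSelmerDualData K γ⁻¹) (𝔮 : PrimeSpectrum (IwasawaAlgebra 7)), 𝔮.asIdeal.height = 1 →
          𝔮.asIdeal = IwasawaAlgebra.augIdealP 7 →
          Module.lengthAt (IwasawaAlgebra 7) Y.X 𝔮 =
            Module.lengthAt (IwasawaAlgebra 7) (I.H ⧸ (IwasawaAlgebra 7) ∙ z₀) 𝔮 :=
  KatoMuResidual.stubKatoMuEqualitySeven_of_residualNonvanishing hchar hFW hGZK
    (residualNonvanishingSeven_of_genus hRes hK2c)

end Summit.BirchSwinnertonDyer.Rank1Residual.Additive.GenusSeven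

end
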